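import Mathlib
import Literature.NumberTheory.Irrationality.BrownZudilin2022.BarnesRepresentation
import Summits.KontsevichZagierPeriods.Zeta5Search.BarnesDouble
import Summits.KontsevichZagierPeriods.Zeta5Search.CellularCubicalSubstitution
import HarnessLib

/-!
# ζ(5) search — the 'trivial' hypergeometric symmetries `p₀₁`, `p₁₂` of `J(p;q)` from (16) (cell `pub-zeta5`, seat ct-1 g11)

HONEST FRAMING: systematic search; no irrationality claim unless kernel-certified. Nothing in this file is an
irrationality result, a worthiness exponent or a denominator statement. With the Barnes-type double integral
(16) a THEOREM (`BarnesDouble.barnes_double_holds`), the first half of Brown–Zudilin's Sect. 7 becomes elementary: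
"the ₃F₂-hypergeometric functions in representation (15) of `J(p;q)` are symmetric with respect to permutations of
their top parameters. Such permutations however affect the factor `p₁!q₁!p₂!p₄!q₄!p₅!q₅!`" — in (16) the two
involutions

* `p₁₂ : (p;q) ↦ (p₀,p₂,p₁,p₃,p₄,p₅,p₆; p₁+q₁−p₂, p₂+q₂−p₁, q₃, q₄, q₅)`,
* `p₀₁ : (p;q) ↦ (p₁,p₀,p₂,p₃,p₄,p₅,p₆; p₁+q₁−p₀, q₂, p₁+q₃−p₀, q₄, q₅)`

[BrownZudilin2022, Sect. 7, displays for `p₁₂` and `p₀₁`] leave the Barnes KERNEL unchanged (`barnesKernel_p12`,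
`barnesKernel_p01`) and the chamber unchanged, so `J` transforms by the ratio of the prefactors:
`J(p₁₂(p;q))·q₁!q₂! = J(p;q)·(p₁+q₁−p₂)!(p₂+q₂−p₁)!` and `J(p₀₁(p;q))·p₁!q₁! = J(p;q)·p₀!(p₁+q₁−p₀)!`
(`Jintegral_p12`, `Jintegral_p01`; likewise their `i₁`-conjugates `p₄₅`, `p₅₆` acting on the `t`-side, `Jintegral_p45`,
`Jintegral_p56` — together with `i₁` (`CubicalForm.Jintegral_reverse`) the generators of the 'trivial' group of order 72 keeping
`J(p;q)/(p₁!p₂!p₄!p₅!q₁!q₂!q₄!q₅!)` invariant), for non-negative letters on both sides and a non-empty chamber — the regime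
in which (16) is stated. On the 8-parameter family (`I(a) = J(p(a);q(a))`, kernel theorem
`CellularCubicalSubstitution.cellularIntegral_eq_Jintegral`) these are the generators `p₀₁`, `p₁₂` of Sect. 7 acting on
`a` (`pOf_genP01`, …), and the invariance of the normalised integral (27) under them follows in that regime
(`normalisedIntegral'_genP12`, `normalisedIntegral'_genP01`: the `p₀₁`- and `p₁₂`-conjuncts of the named fact
`invariance_of_converges'`, under the extra hypothesis that `(p(a);q(a))` admits a chamber point).
Theorems only (no new definitions).
-/

noncomputable section

namespace Summit.KontsevichZagierPeriods.Zeta5Search.BarnesSymmetry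

open MeasureTheory Set
open scoped Real
open Literature.NumberTheory.Irrationality.BrownZudilin2022
open Summit.KontsevichZagierPeriods.Zeta5Search.WedgeDictionary.Kernel (barnesPrefactor_pos)
open Summit.KontsevichZagierPeriods.Zeta5Search.BarnesDouble (barnes_double_holds)
open Summit.KontsevichZagierPeriods.Zeta5Search.CellularCubicalSubstitution (cellularIntegral_eq_Jintegral)

/-! ### `p₁₂` -/

/-- The Barnes kernel is invariant under `p₁₂` (permutation of `Γ(p₁+1+s)`, `Γ(p₂+1+s)`; the lower parameters
`p₁+q₁+2`, `p₂+q₂+2` are kept). [BrownZudilin2022, Sect. 7] -/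
theorem barnesKernel_p12 (p : Fin 7 → ℤ) (q : Fin 5 → ℤ) (s t : ℂ) :
    barnesKernel ![p 0, p 2, p 1, p 3, p 4, p 5, p 6] ![p 1 + q 0 - p 2, p 2 + q 1 - p 1, q 2, q 3, q 4] s t =
      barnesKernel p q s t := by
  unfold barnesKernel
  simp only [Matrix.cons_val_zero, Matrix.cons_val_one, Matrix.cons_val]
  push_cast
  ring_nf

/-- The chamber is invariant under `p₁₂`. -/
theorem chamber_p12 {p : Fin 7 → ℤ} {q : Fin 5 → ℤ} {c₁ c₂ : ℝ} (h : Chamber p q c₁ c₂) :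
    Chamber ![p 0, p 2, p 1, p 3, p 4, p 5, p 6] ![p 1 + q 0 - p 2, p 2 + q 1 - p 1, q 2, q 3, q 4] c₁ c₂ := by
  obtain ⟨h1, h2, h3, h4, h5, h6⟩ := h
  refine ⟨h1, ?_, h3, ?_, ?_, ?_⟩ <;>
    simp only [Matrix.cons_val_zero, Matrix.cons_val_one, Matrix.cons_val] <;> try assumption
  · rw [min_comm (p 2) (p 1)]; exact h2

/-- **`J` under `p₁₂`** [BrownZudilin2022, Sect. 7, display for the symmetry of `p₁+1`, `p₂+1`]:
`J(p₁₂(p;q)) · q₁! q₂! = J(p;q) · (p₁+q₁−p₂)! (p₂+q₂−p₁)!`, for non-negative letters and a non-empty chamber. -/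
theorem Jintegral_p12 (p : Fin 7 → ℤ) (q : Fin 5 → ℤ) (hp : ∀ i, 0 ≤ p i) (hq : ∀ j, 0 ≤ q j)
    (h12 : 0 ≤ p 1 + q 0 - p 2) (h21 : 0 ≤ p 2 + q 1 - p 1) {c₁ c₂ : ℝ} (hch : Chamber p q c₁ c₂) :
    Jintegral ![p 0, p 2, p 1, p 3, p 4, p 5, p 6] ![p 1 + q 0 - p 2, p 2 + q 1 - p 1, q 2, q 3, q 4] *
        (((q 0).toNat.factorial * (q 1).toNat.factorial : ℕ) : ℝ) =
      Jintegral p q * ((((p 1 + q 0 - p 2).toNat.factorial * (p 2 + q 1 - p 1).toNat.factorial : ℕ)) : ℝ) := by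
  set p' : Fin 7 → ℤ := ![p 0, p 2, p 1, p 3, p 4, p 5, p 6] with hp'
  set q' : Fin 5 → ℤ := ![p 1 + q 0 - p 2, p 2 + q 1 - p 1, q 2, q 3, q 4] with hq'
  have hp'' : ∀ i, 0 ≤ p' i := by intro i; fin_cases i <;> simp [hp', hp]
  have hq'' : ∀ j, 0 ≤ q' j := by intro j; fin_cases j <;> simp [hq', hq] <;> omega
  obtain ⟨-, hJ⟩ := barnes_double_holds p q c₁ c₂ hp hq hch
  obtain ⟨-, hJ'⟩ := barnes_double_holds p' q' c₁ c₂ hp'' hq'' (chamber_p12 hch)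
  simp_rw [hp', hq', barnesKernel_p12] at hJ'
  have hK := barnesPrefactor_pos p q
  have hreal : Jintegral p' q' * barnesPrefactor p q = Jintegral p q * barnesPrefactor p' q' := by
    have hc : (Jintegral p' q' : ℂ) * (barnesPrefactor p q : ℂ) = (Jintegral p q : ℂ) * (barnesPrefactor p' q' : ℂ) := by
      rw [hJ, hp', hq', hJ']; ring
    exact_mod_cast hc
  have hKK : barnesPrefactor p' q' * (((q 0).toNat.factorial * (q 1).toNat.factorial : ℕ) : ℝ) =
      barnesPrefactor p q * ((((p 1 + q 0 - p 2).toNat.factorial * (p 2 + q 1 - p 1).toNat.factorial : ℕ)) : ℝ) := by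
    unfold barnesPrefactor
    simp only [hp', hq', Matrix.cons_val_zero, Matrix.cons_val_one, Matrix.cons_val]
    push_cast
    field_simp
  refine mul_left_cancel₀ hK.ne' ?_
  linear_combination (((q 0).toNat.factorial * (q 1).toNat.factorial : ℕ) : ℝ) * hreal + Jintegral p q * hKK

/-! ### `p₀₁` -/

/-- The Barnes kernel is invariant under `p₀₁` (permutation of `Γ(p₀+1+s)`, `Γ(p₁+1+s)`; `p₁+q₁+2` and
`q₃−p₀` are kept). [BrownZudilin2022, Sect. 7] -/
theorem barnesKernel_p01 (p : Fin 7 → ℤ) (q : Fin 5 → ℤ) (s t : ℂ) :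
    barnesKernel ![p 1, p 0, p 2, p 3, p 4, p 5, p 6] ![p 1 + q 0 - p 0, q 1, p 1 + q 2 - p 0, q 3, q 4] s t =
      barnesKernel p q s t := by
  unfold barnesKernel
  simp only [Matrix.cons_val_zero, Matrix.cons_val_one, Matrix.cons_val]
  push_cast
  ring_nf

/-- The chamber is invariant under `p₀₁`. -/
theorem chamber_p01 {p : Fin 7 → ℤ} {q : Fin 5 → ℤ} {c₁ c₂ : ℝ} (h : Chamber p q c₁ c₂) :
    Chamber ![p 1, p 0, p 2, p 3, p 4, p 5, p 6] ![p 1 + q 0 - p 0, q 1, p 1 + q 2 - p 0, q 3, q 4] c₁ c₂ := by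
  obtain ⟨h1, h2, h3, h4, h5, h6⟩ := h
  refine ⟨h1, ?_, h3, ?_, ?_, ?_⟩ <;>
    simp only [Matrix.cons_val_zero, Matrix.cons_val_one, Matrix.cons_val] <;> try assumption
  · rw [min_left_comm]; exact h2
  · push_cast; linarith

/-- **`J` under `p₀₁`** [BrownZudilin2022, Sect. 7, display for the symmetry of `p₀+1`, `p₁+1`]:
`J(p₀₁(p;q)) · p₁! q₁! = J(p;q) · p₀! (p₁+q₁−p₀)!`, for non-negative letters and a non-empty chamber. -/
theorem Jintegral_p01 (p : Fin 7 → ℤ) (q : Fin 5 → ℤ) (hp : ∀ i, 0 ≤ p i) (hq : ∀ j, 0 ≤ q j)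
    (h10 : 0 ≤ p 1 + q 0 - p 0) (h30 : 0 ≤ p 1 + q 2 - p 0) {c₁ c₂ : ℝ} (hch : Chamber p q c₁ c₂) :
    Jintegral ![p 1, p 0, p 2, p 3, p 4, p 5, p 6] ![p 1 + q 0 - p 0, q 1, p 1 + q 2 - p 0, q 3, q 4] *
        (((p 1).toNat.factorial * (q 0).toNat.factorial : ℕ) : ℝ) =
      Jintegral p q * ((((p 0).toNat.factorial * (p 1 + q 0 - p 0).toNat.factorial : ℕ)) : ℝ) := by
  set p' : Fin 7 → ℤ := ![p 1, p 0, p 2, p 3, p 4, p 5, p 6] with hp'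
  set q' : Fin 5 → ℤ := ![p 1 + q 0 - p 0, q 1, p 1 + q 2 - p 0, q 3, q 4] with hq'
  have hp'' : ∀ i, 0 ≤ p' i := by intro i; fin_cases i <;> simp [hp', hp]
  have hq'' : ∀ j, 0 ≤ q' j := by intro j; fin_cases j <;> simp [hq', hq] <;> omega
  obtain ⟨-, hJ⟩ := barnes_double_holds p q c₁ c₂ hp hq hch
  obtain ⟨-, hJ'⟩ := barnes_double_holds p' q' c₁ c₂ hp'' hq'' (chamber_p01 hch)
  simp_rw [hp', hq', barnesKernel_p01] at hJ'
  have hK := barnesPrefactor_pos p q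
  have hreal : Jintegral p' q' * barnesPrefactor p q = Jintegral p q * barnesPrefactor p' q' := by
    have hc : (Jintegral p' q' : ℂ) * (barnesPrefactor p q : ℂ) = (Jintegral p q : ℂ) * (barnesPrefactor p' q' : ℂ) := by
      rw [hJ, hp', hq', hJ']; ring
    exact_mod_cast hc
  have hD : p 3 + (p 1 + q 2 - p 0) - p 1 - p 6 = p 3 + q 2 - p 0 - p 6 := by ring
  have hKK : barnesPrefactor p' q' * (((p 1).toNat.factorial * (q 0).toNat.factorial : ℕ) : ℝ) =
      barnesPrefactor p q * ((((p 0).toNat.factorial * (p 1 + q 0 - p 0).toNat.factorial : ℕ)) : ℝ) := by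
    unfold barnesPrefactor
    simp only [hp', hq', Matrix.cons_val_zero, Matrix.cons_val_one, Matrix.cons_val, hD]
    push_cast
    field_simp
  refine mul_left_cancel₀ hK.ne' ?_
  linear_combination (((p 1).toNat.factorial * (q 0).toNat.factorial : ℕ) : ℝ) * hreal + Jintegral p q * hKK


/-! ### The `i₁`-conjugates `p₄₅ = i₁p₁₂i₁`, `p₅₆ = i₁p₀₁i₁` (also plain kernel symmetries) -/

/-- The Barnes kernel is invariant under `p₄₅ : (p;q) ↦ (p₀,p₁,p₂,p₃,p₅,p₄,p₆; q₁,q₂,q₃, p₄+q₄−p₅, p₅+q₅−p₄)`.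
[BrownZudilin2022, Sect. 7] -/
theorem barnesKernel_p45 (p : Fin 7 → ℤ) (q : Fin 5 → ℤ) (s t : ℂ) :
    barnesKernel ![p 0, p 1, p 2, p 3, p 5, p 4, p 6] ![q 0, q 1, q 2, p 4 + q 3 - p 5, p 5 + q 4 - p 4] s t =
      barnesKernel p q s t := by
  unfold barnesKernel
  simp only [Matrix.cons_val_zero, Matrix.cons_val_one, Matrix.cons_val]
  push_cast
  ring_nf

/-- The chamber is invariant under `p₄₅`. -/
theorem chamber_p45 {p : Fin 7 → ℤ} {q : Fin 5 → ℤ} {c₁ c₂ : ℝ} (h : Chamber p q c₁ c₂) :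
    Chamber ![p 0, p 1, p 2, p 3, p 5, p 4, p 6] ![q 0, q 1, q 2, p 4 + q 3 - p 5, p 5 + q 4 - p 4] c₁ c₂ := by
  obtain ⟨h1, h2, h3, h4, h5, h6⟩ := h
  refine ⟨h1, ?_, h3, ?_, ?_, ?_⟩ <;>
    simp only [Matrix.cons_val_zero, Matrix.cons_val_one, Matrix.cons_val] <;> try assumption
  · rw [min_left_comm]; exact h4

/-- **`J` under `p₄₅`** [BrownZudilin2022, Sect. 7]: `J(p₄₅(p;q)) · q₄! q₅! = J(p;q) · (p₄+q₄−p₅)! (p₅+q₅−p₄)!`. -/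
theorem Jintegral_p45 (p : Fin 7 → ℤ) (q : Fin 5 → ℤ) (hp : ∀ i, 0 ≤ p i) (hq : ∀ j, 0 ≤ q j)
    (h45 : 0 ≤ p 4 + q 3 - p 5) (h54 : 0 ≤ p 5 + q 4 - p 4) {c₁ c₂ : ℝ} (hch : Chamber p q c₁ c₂) :
    Jintegral ![p 0, p 1, p 2, p 3, p 5, p 4, p 6] ![q 0, q 1, q 2, p 4 + q 3 - p 5, p 5 + q 4 - p 4] *
        (((q 3).toNat.factorial * (q 4).toNat.factorial : ℕ) : ℝ) =
      Jintegral p q * ((((p 4 + q 3 - p 5).toNat.factorial * (p 5 + q 4 - p 4).toNat.factorial : ℕ)) : ℝ) := by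
  set p' : Fin 7 → ℤ := ![p 0, p 1, p 2, p 3, p 5, p 4, p 6] with hp'
  set q' : Fin 5 → ℤ := ![q 0, q 1, q 2, p 4 + q 3 - p 5, p 5 + q 4 - p 4] with hq'
  have hp'' : ∀ i, 0 ≤ p' i := by intro i; fin_cases i <;> simp [hp', hp]
  have hq'' : ∀ j, 0 ≤ q' j := by intro j; fin_cases j <;> simp [hq', hq] <;> omega
  obtain ⟨-, hJ⟩ := barnes_double_holds p q c₁ c₂ hp hq hch
  obtain ⟨-, hJ'⟩ := barnes_double_holds p' q' c₁ c₂ hp'' hq'' (chamber_p45 hch)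
  simp_rw [hp', hq', barnesKernel_p45] at hJ'
  have hK := barnesPrefactor_pos p q
  have hreal : Jintegral p' q' * barnesPrefactor p q = Jintegral p q * barnesPrefactor p' q' := by
    have hc : (Jintegral p' q' : ℂ) * (barnesPrefactor p q : ℂ) = (Jintegral p q : ℂ) * (barnesPrefactor p' q' : ℂ) := by
      rw [hJ, hp', hq', hJ']; ring
    exact_mod_cast hc
  have hKK : barnesPrefactor p' q' * (((q 3).toNat.factorial * (q 4).toNat.factorial : ℕ) : ℝ) =
      barnesPrefactor p q * ((((p 4 + q 3 - p 5).toNat.factorial * (p 5 + q 4 - p 4).toNat.factorial : ℕ)) : ℝ) := by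
    unfold barnesPrefactor
    simp only [hp', hq', Matrix.cons_val_zero, Matrix.cons_val_one, Matrix.cons_val]
    push_cast
    field_simp
  refine mul_left_cancel₀ hK.ne' ?_
  linear_combination (((q 3).toNat.factorial * (q 4).toNat.factorial : ℕ) : ℝ) * hreal + Jintegral p q * hKK

/-- The Barnes kernel is invariant under `p₅₆ : (p;q) ↦ (p₀,p₁,p₂,p₃,p₄,p₆,p₅; q₁,q₂, p₅+q₃−p₆, q₄, p₅+q₅−p₆)`.
[BrownZudilin2022, Sect. 7] -/
theorem barnesKernel_p56 (p : Fin 7 → ℤ) (q : Fin 5 → ℤ) (s t : ℂ) :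
    barnesKernel ![p 0, p 1, p 2, p 3, p 4, p 6, p 5] ![q 0, q 1, p 5 + q 2 - p 6, q 3, p 5 + q 4 - p 6] s t =
      barnesKernel p q s t := by
  unfold barnesKernel
  simp only [Matrix.cons_val_zero, Matrix.cons_val_one, Matrix.cons_val]
  push_cast
  ring_nf

/-- The chamber is invariant under `p₅₆`. -/
theorem chamber_p56 {p : Fin 7 → ℤ} {q : Fin 5 → ℤ} {c₁ c₂ : ℝ} (h : Chamber p q c₁ c₂) :
    Chamber ![p 0, p 1, p 2, p 3, p 4, p 6, p 5] ![q 0, q 1, p 5 + q 2 - p 6, q 3, p 5 + q 4 - p 6] c₁ c₂ := by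
  obtain ⟨h1, h2, h3, h4, h5, h6⟩ := h
  refine ⟨h1, ?_, h3, ?_, ?_, ?_⟩ <;>
    simp only [Matrix.cons_val_zero, Matrix.cons_val_one, Matrix.cons_val] <;> try assumption
  · rw [min_comm (p 6) (p 5)]; exact h4
  · push_cast; linarith

/-- **`J` under `p₅₆`** [BrownZudilin2022, Sect. 7]: `J(p₅₆(p;q)) · p₅! q₅! = J(p;q) · p₆! (p₅+q₅−p₆)!`. -/
theorem Jintegral_p56 (p : Fin 7 → ℤ) (q : Fin 5 → ℤ) (hp : ∀ i, 0 ≤ p i) (hq : ∀ j, 0 ≤ q j)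
    (h36 : 0 ≤ p 5 + q 2 - p 6) (h56 : 0 ≤ p 5 + q 4 - p 6) {c₁ c₂ : ℝ} (hch : Chamber p q c₁ c₂) :
    Jintegral ![p 0, p 1, p 2, p 3, p 4, p 6, p 5] ![q 0, q 1, p 5 + q 2 - p 6, q 3, p 5 + q 4 - p 6] *
        (((p 5).toNat.factorial * (q 4).toNat.factorial : ℕ) : ℝ) =
      Jintegral p q * ((((p 6).toNat.factorial * (p 5 + q 4 - p 6).toNat.factorial : ℕ)) : ℝ) := by
  set p' : Fin 7 → ℤ := ![p 0, p 1, p 2, p 3, p 4, p 6, p 5] with hp'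
  set q' : Fin 5 → ℤ := ![q 0, q 1, p 5 + q 2 - p 6, q 3, p 5 + q 4 - p 6] with hq'
  have hp'' : ∀ i, 0 ≤ p' i := by intro i; fin_cases i <;> simp [hp', hp]
  have hq'' : ∀ j, 0 ≤ q' j := by intro j; fin_cases j <;> simp [hq', hq] <;> omega
  obtain ⟨-, hJ⟩ := barnes_double_holds p q c₁ c₂ hp hq hch
  obtain ⟨-, hJ'⟩ := barnes_double_holds p' q' c₁ c₂ hp'' hq'' (chamber_p56 hch)
  simp_rw [hp', hq', barnesKernel_p56] at hJ'
  have hK := barnesPrefactor_pos p q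
  have hreal : Jintegral p' q' * barnesPrefactor p q = Jintegral p q * barnesPrefactor p' q' := by
    have hc : (Jintegral p' q' : ℂ) * (barnesPrefactor p q : ℂ) = (Jintegral p q : ℂ) * (barnesPrefactor p' q' : ℂ) := by
      rw [hJ, hp', hq', hJ']; ring
    exact_mod_cast hc
  have hD : p 3 + (p 5 + q 2 - p 6) - p 0 - p 5 = p 3 + q 2 - p 0 - p 6 := by ring
  have hKK : barnesPrefactor p' q' * (((p 5).toNat.factorial * (q 4).toNat.factorial : ℕ) : ℝ) =
      barnesPrefactor p q * ((((p 6).toNat.factorial * (p 5 + q 4 - p 6).toNat.factorial : ℕ)) : ℝ) := by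
    unfold barnesPrefactor
    simp only [hp', hq', Matrix.cons_val_zero, Matrix.cons_val_one, Matrix.cons_val, hD]
    push_cast
    field_simp
  refine mul_left_cancel₀ hK.ne' ?_
  linear_combination (((p 5).toNat.factorial * (q 4).toNat.factorial : ℕ) : ℝ) * hreal + Jintegral p q * hKK

/-! ### The generators `p₁₂`, `p₀₁` on the 8-parameter family -/

/-- `(p;q)(p₁₂ a) = p₁₂((p;q)(a))`, `p`-part. [BrownZudilin2022, Sect. 7–8] -/
theorem pOf_genP12 (a : Fin 8 → ℤ) :
    pOf (genP12 a) = ![pOf a 0, pOf a 2, pOf a 1, pOf a 3, pOf a 4, pOf a 5, pOf a 6] := by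
  ext i; fin_cases i <;> simp [pOf, genP12] <;> ring

/-- `(p;q)(p₁₂ a) = p₁₂((p;q)(a))`, `q`-part. [BrownZudilin2022, Sect. 7–8] -/
theorem qOf_genP12 (a : Fin 8 → ℤ) :
    qOf (genP12 a) = ![pOf a 1 + qOf a 0 - pOf a 2, pOf a 2 + qOf a 1 - pOf a 1, qOf a 2, qOf a 3, qOf a 4] := by
  ext i; fin_cases i <;> simp [pOf, qOf, genP12] <;> ring

/-- `(p;q)(p₀₁ a) = p₀₁((p;q)(a))`, `p`-part. [BrownZudilin2022, Sect. 7–8] -/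
theorem pOf_genP01 (a : Fin 8 → ℤ) :
    pOf (genP01 a) = ![pOf a 1, pOf a 0, pOf a 2, pOf a 3, pOf a 4, pOf a 5, pOf a 6] := by
  ext i; fin_cases i <;> simp [pOf, genP01] <;> ring

/-- `(p;q)(p₀₁ a) = p₀₁((p;q)(a))`, `q`-part. [BrownZudilin2022, Sect. 7–8] -/
theorem qOf_genP01 (a : Fin 8 → ℤ) :
    qOf (genP01 a) = ![pOf a 1 + qOf a 0 - pOf a 0, qOf a 1, pOf a 1 + qOf a 2 - pOf a 0, qOf a 3, qOf a 4] := by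
  ext i; fin_cases i <;> simp [pOf, qOf, genP01] <;> ring

/-- Convergence plus a chamber point force all twelve letters `(p(a);q(a))` to be `≥ 0`. -/
theorem letters_nonneg_of_chamber {a : Fin 8 → ℤ} (ha : Converges a) {c₁ c₂ : ℝ} (hch : Chamber (pOf a) (qOf a) c₁ c₂) :
    (∀ i, 0 ≤ pOf a i) ∧ (∀ j, 0 ≤ qOf a j) := by
  obtain ⟨hc1, b0, b1, b2, hc2, b4, b5, b6, hlo, hhi⟩ := BarnesCube.chamber_bounds hch
  have g0 := ha (a 0) (by simp [convergenceForms]); have g1 := ha (a 1) (by simp [convergenceForms])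
  have g2 := ha (a 2) (by simp [convergenceForms]); have g3 := ha (a 3) (by simp [convergenceForms])
  have g4 := ha (a 4) (by simp [convergenceForms]); have g5 := ha (a 5) (by simp [convergenceForms])
  have g6 := ha (a 6) (by simp [convergenceForms])
  have g10 := ha (a 0 + a 4 - a 2) (by simp [convergenceForms])
  have g14 := ha (a 2 + a 5 - a 7) (by simp [convergenceForms])
  have g23 := ha (a 1 + a 2 + a 5 - a 3 - a 7) (by simp [convergenceForms])
  have e0 : ((pOf a 0 : ℤ) : ℝ) > -1 := by linarith
  have e6 : ((pOf a 6 : ℤ) : ℝ) > -1 := by linarith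
  have f0 : -1 < pOf a 0 := by exact_mod_cast e0
  have f6 : -1 < pOf a 6 := by exact_mod_cast e6
  simp [pOf, qOf] at f0 f6 ⊢
  constructor
  · intro i; fin_cases i <;> simp <;> omega
  · intro j; fin_cases j <;> simp <;> omega

/-- **`I` under `p₁₂`**: `I(p₁₂ a)·q₁!q₂! = I(a)·(p₁+q₁−p₂)!(p₂+q₂−p₁)!` (letters of `a`), for `a` and `p₁₂ a`
convergent and a chamber point for `(p(a);q(a))`. [BrownZudilin2022, Sect. 7] -/
theorem cellularIntegral_genP12 {a : Fin 8 → ℤ} (ha : Converges a) (hga : Converges (genP12 a)) {c₁ c₂ : ℝ}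
    (hch : Chamber (pOf a) (qOf a) c₁ c₂) :
    cellularIntegral (genP12 a) * (((qOf a 0).toNat.factorial * (qOf a 1).toNat.factorial : ℕ) : ℝ) =
      cellularIntegral a * ((((pOf a 1 + qOf a 0 - pOf a 2).toNat.factorial *
        (pOf a 2 + qOf a 1 - pOf a 1).toNat.factorial : ℕ)) : ℝ) := by
  obtain ⟨hp, hq⟩ := letters_nonneg_of_chamber ha hch
  have h12 : 0 ≤ pOf a 1 + qOf a 0 - pOf a 2 := by
    have := hga (a 1 + a 2 - a 7) (by simp [convergenceForms, genP12])
    simp [pOf, qOf]; omega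
  have h21 : 0 ≤ pOf a 2 + qOf a 1 - pOf a 1 := by
    have := hga (a 3 + a 4 + a 7 - a 1 - a 2) (by simp [convergenceForms, genP12])
    simp [pOf, qOf]; omega
  rw [cellularIntegral_eq_Jintegral, cellularIntegral_eq_Jintegral, pOf_genP12, qOf_genP12]
  exact Jintegral_p12 (pOf a) (qOf a) hp hq h12 h21 hch

/-- **`I` under `p₀₁`**: `I(p₀₁ a)·p₁!q₁! = I(a)·p₀!(p₁+q₁−p₀)!` (letters of `a`), for `a` and `p₀₁ a` convergent and
a chamber point for `(p(a);q(a))`. [BrownZudilin2022, Sect. 7] -/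
theorem cellularIntegral_genP01 {a : Fin 8 → ℤ} (ha : Converges a) (hga : Converges (genP01 a)) {c₁ c₂ : ℝ}
    (hch : Chamber (pOf a) (qOf a) c₁ c₂) :
    cellularIntegral (genP01 a) * (((pOf a 1).toNat.factorial * (qOf a 0).toNat.factorial : ℕ) : ℝ) =
      cellularIntegral a * ((((pOf a 0).toNat.factorial * (pOf a 1 + qOf a 0 - pOf a 0).toNat.factorial : ℕ)) : ℝ) := by
  obtain ⟨hp, hq⟩ := letters_nonneg_of_chamber ha hch
  have h10 : 0 ≤ pOf a 1 + qOf a 0 - pOf a 0 := by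
    have := hga (a 1 + a 2 - a 4) (by simp [convergenceForms, genP01])
    simp [pOf, qOf]; omega
  have h30 : 0 ≤ pOf a 1 + qOf a 2 - pOf a 0 := by
    have := hga (a 0 + a 4 - (a 3 + a 4 - a 1)) (by simp [convergenceForms, genP01])
    simp [pOf, qOf]; omega
  rw [cellularIntegral_eq_Jintegral, cellularIntegral_eq_Jintegral, pOf_genP01, qOf_genP01]
  exact Jintegral_p01 (pOf a) (qOf a) hp hq h10 h30 hch

/-! ### The normalised integral (27) under `p₁₂`, `p₀₁` -/

/-- The normalisation `∏_{i∈F} h_i(a)!` of (27) is positive. -/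
theorem normF_pos (a : Fin 8 → ℤ) : 0 < ((Fset.map fun i => ((hForm a i).toNat.factorial : ℝ)).prod) := by
  simp only [Fset, List.map_cons, List.map_nil, List.prod_cons, List.prod_nil]
  positivity

/-- Bookkeeping of `∏_{i∈F} h_i!` under `p₁₂`: the multiset `{h_i(p₁₂ a)}_{i∈F}` is `{h_i(a)}_{i∈F}` with `q₁, q₂`
replaced by `p₁+q₁−p₂, p₂+q₂−p₁`. [BrownZudilin2022, Sect. 7, (26)–(27)] -/
theorem normF_genP12 (a : Fin 8 → ℤ) :
    ((Fset.map fun i => ((hForm (genP12 a) i).toNat.factorial : ℝ)).prod) *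
        (((qOf a 0).toNat.factorial * (qOf a 1).toNat.factorial : ℕ) : ℝ) =
      ((Fset.map fun i => ((hForm a i).toNat.factorial : ℝ)).prod) *
        ((((pOf a 1 + qOf a 0 - pOf a 2).toNat.factorial * (pOf a 2 + qOf a 1 - pOf a 1).toNat.factorial : ℕ)) : ℝ) := by
  simp [Fset, hForm, hList, genP12, pOf, qOf]
  ring_nf

/-- Bookkeeping of `∏_{i∈F} h_i!` under `p₀₁`: `q₁, p₁` are replaced by `p₀, p₁+q₁−p₀`. [BrownZudilin2022, Sect. 7, (26)–(27)] -/
theorem normF_genP01 (a : Fin 8 → ℤ) :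
    ((Fset.map fun i => ((hForm (genP01 a) i).toNat.factorial : ℝ)).prod) *
        (((pOf a 1).toNat.factorial * (qOf a 0).toNat.factorial : ℕ) : ℝ) =
      ((Fset.map fun i => ((hForm a i).toNat.factorial : ℝ)).prod) *
        ((((pOf a 0).toNat.factorial * (pOf a 1 + qOf a 0 - pOf a 0).toNat.factorial : ℕ)) : ℝ) := by
  simp [Fset, hForm, hList, genP01, pOf, qOf]
  ring_nf

/-- **(27) under `p₁₂`** — the `p₁₂`-conjunct of `invariance_of_converges'` in the regime of (16):
`I(p₁₂ a)/∏_{i∈F} h_i(p₁₂ a)! = I(a)/∏_{i∈F} h_i(a)!` for `a`, `p₁₂ a` convergent and a chamber point for `(p(a);q(a))`.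
[BrownZudilin2022, Sect. 7, eq. (27)] -/
theorem normalisedIntegral'_genP12 {a : Fin 8 → ℤ} (ha : Converges a) (hga : Converges (genP12 a)) {c₁ c₂ : ℝ}
    (hch : Chamber (pOf a) (qOf a) c₁ c₂) : normalisedIntegral' (genP12 a) = normalisedIntegral' a := by
  have hI := cellularIntegral_genP12 ha hga hch
  have hP := normF_genP12 a
  have hc : (((qOf a 0).toNat.factorial * (qOf a 1).toNat.factorial : ℕ) : ℝ) ≠ 0 := by positivity
  unfold normalisedIntegral'
  rw [div_eq_div_iff (normF_pos _).ne' (normF_pos _).ne']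
  refine mul_right_cancel₀ hc ?_
  linear_combination ((Fset.map fun i => ((hForm a i).toNat.factorial : ℝ)).prod) * hI - cellularIntegral a * hP

/-- **(27) under `p₀₁`** — the `p₀₁`-conjunct of `invariance_of_converges'` in the regime of (16).
[BrownZudilin2022, Sect. 7, eq. (27)] -/
theorem normalisedIntegral'_genP01 {a : Fin 8 → ℤ} (ha : Converges a) (hga : Converges (genP01 a)) {c₁ c₂ : ℝ}
    (hch : Chamber (pOf a) (qOf a) c₁ c₂) : normalisedIntegral' (genP01 a) = normalisedIntegral' a := by
  have hI := cellularIntegral_genP01 ha hga hch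
  have hP := normF_genP01 a
  have hc : (((pOf a 1).toNat.factorial * (qOf a 0).toNat.factorial : ℕ) : ℝ) ≠ 0 := by positivity
  unfold normalisedIntegral'
  rw [div_eq_div_iff (normF_pos _).ne' (normF_pos _).ne']
  refine mul_right_cancel₀ hc ?_
  linear_combination ((Fset.map fun i => ((hForm a i).toNat.factorial : ℝ)).prod) * hI - cellularIntegral a * hP

end Summit.KontsevichZagierPeriods.Zeta5Search.BarnesSymmetry

end
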